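import Summits.KontsevichZagierPeriods.KontsevichZagierPeriods.Theorems.SoloInformedStabilisation
import Summits.KontsevichZagierPeriods.KontsevichZagierPeriods.Theorems.SoloInformedEquidimAssoc
import Summits.KontsevichZagierPeriods.KontsevichZagierPeriods.Theorems.SoloInformedPiLocalAnchor
import HarnessLib
import HarnessLib.Audit

/-!
# SoloInformed — disc regularity `T₁₂` on the equidimensional group and `π`-cancellation (COROLLARY NF.3 (a)–(c), kernel)

Solo programme `solo-KontsevichZagierPeriods-informed`, session s246 (typed question `T₁₂` of
`paper/nl-elimination.md`, COROLLARY NF.3 / REMARK NF.5, made kernel; companion of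
`SoloInformedStabilisation`).

`KZ.PiCancellation` ("`[π] * c ∈ relations → c ∈ relations`", conjunct (2) of the summit:
`KontsevichZagierPeriods ↔ KZ.PiLocalKernel ∧ KZ.PiCancellation`,
`soloInformed_kzp_iff_piLocalKernel_and_piCancellation`) has an equidimensional shadow on the graded
group `P₁₂ = FormalRep ⧸ relations₁₂` of THEOREM NF:

* `SoloInformedDiscRegularAt d` (**T₁₂ in degree `d`**): for `x` homogeneous of degree `d`,
  `[π] * x ∈ relations₁₂ → x ∈ relations₁₂`; `SoloInformedDiscRegular` = every degree.

Proved here (all unconditional):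

* `soloInformed_dimProj_piRep_mul` — disc insertion is homogeneous of degree `2`:
  `π_{d+2} ([π] * x) = [π] * π_d x` (and `π_0`, `π_1` of `[π] * x` vanish);
* `soloInformed_totalFlat_piRep_mul_sub_mem` — **`Φ_{N+2} ([π] * c) ≡ [π] * Φ_N c (mod relations₁₂)`**
  (total flattening commutes with disc insertion; from COROLLARY NF.3 `Fl ([π] * c) ≡ [π] * Fl c`);
* **`soloInformed_piCancellation_of_discRegular`** — COROLLARY NF.3(b): `T₁₂ → KZ.PiCancellation`
  (no stabilisation hypothesis: the torsion form of `relations` absorbs it), whence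
  `soloInformed_summit_of_piLocalKernel_of_discRegular : KZ.PiLocalKernel → T₁₂ → KontsevichZagierPeriods`;
* `soloInformed_discRegular_of_piCancellation_of_stab` — COROLLARY NF.3(c): under STAB,
  `KZ.PiCancellation ↔ T₁₂`;
* `soloInformed_discRegular_of_equidimInj` — GKZ^dens `→ T₁₂`; `soloInformed_discRegularAt_zero` —
  `T₁₂` holds in degree `0`.

References: M. Kontsevich, D. Zagier, *Periods* (2001), §1.2, §4.1; J. Ayoub, *Periods and the
conjectures of Grothendieck and Kontsevich–Zagier* (2014), Conj. 7; A. Huber, G. Wüstholz,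
*Transcendence and linear relations of 1-periods* (2022), App. A; this work (THEOREM NF,
COROLLARY NF.3, `paper/nl-elimination.md`).
-/

noncomputable section

open scoped BigOperators

namespace Summit.KontsevichZagierPeriods.KontsevichZagierPeriods.Theorems

open Set MeasureTheory
open Literature.ModelTheory.ExponentialFields
open Literature.NumberTheory.Transcendental Literature.NumberTheory.Transcendental.KZ

variable {n d : ℕ}

/-! ### `T₁₂`: disc regularity on the equidimensional group -/

/-- **`T₁₂` in degree `d`**: `[π]` is a non-zero-divisor on the degree-`d` part of
`FormalRep ⧸ relations₁₂` — for `x` homogeneous of degree `d`, `[π] * x ∈ relations₁₂ → x ∈ relations₁₂`.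
Open for `d ≥ 1`; `d = 0` is `soloInformed_discRegularAt_zero`. [this work, COROLLARY NF.3 (typed question T₁₂)] -/
def SoloInformedDiscRegularAt (d : ℕ) : Prop :=
  ∀ x : FormalRep, soloInformedDimProj d x = x →
    of piRep * x ∈ soloInformedEquidimRelations → x ∈ soloInformedEquidimRelations

/-- **`T₁₂`**: disc regularity in every degree. [this work, COROLLARY NF.3] -/
def SoloInformedDiscRegular : Prop :=
  ∀ d : ℕ, SoloInformedDiscRegularAt d

/-! ### Disc insertion and the grading -/

/-- **Disc insertion is homogeneous of degree `2`**: `π_{d+2} ([π] * x) = [π] * π_d x`.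
[Kontsevich–Zagier 2001, §1.2] -/
theorem soloInformed_dimProj_piRep_mul (d : ℕ) (x : FormalRep) :
    soloInformedDimProj (d + 2) (of piRep * x) = of piRep * soloInformedDimProj d x := by
  induction x using FreeAbelianGroup.induction_on with
  | zero => rw [mul_zero, map_zero, map_zero, mul_zero]
  | of x =>
    obtain ⟨n, r⟩ := x
    change soloInformedDimProj (d + 2) (of piRep * of r) = of piRep * soloInformedDimProj d (of r)
    rw [of_mul_of, soloInformed_dimProj_of, soloInformed_dimProj_of]
    by_cases h : n = d
    · rw [if_pos (by omega), if_pos h, of_mul_of]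
    · rw [if_neg (by omega), if_neg h, mul_zero]
  | neg x ih => rw [mul_neg, map_neg, map_neg, mul_neg, ih]
  | add x y hx hy => rw [mul_add, map_add, map_add, mul_add, hx, hy]

/-- `[π] * x` has no components of degree `< 2`. [Kontsevich–Zagier 2001, §1.2] -/
theorem soloInformed_dimProj_piRep_mul_eq_zero {j : ℕ} (hj : j < 2) (x : FormalRep) :
    soloInformedDimProj j (of piRep * x) = 0 := by
  induction x using FreeAbelianGroup.induction_on with
  | zero => rw [mul_zero, map_zero]
  | of x =>
    obtain ⟨n, r⟩ := x
    change soloInformedDimProj j (of piRep * of r) = 0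
    rw [of_mul_of, soloInformed_dimProj_of_ne (by omega)]
  | neg x ih => rw [mul_neg, map_neg, ih, neg_zero]
  | add x y hx hy => rw [mul_add, map_add, hx, hy, add_zero]

/-- For `x` homogeneous of degree `d`, `[π] * x` is homogeneous of degree `d + 2`. [this work] -/
theorem soloInformed_dimProj_piRep_mul_of_eq {x : FormalRep} (hx : soloInformedDimProj d x = x) :
    soloInformedDimProj (d + 2) (of piRep * x) = of piRep * x := by
  rw [soloInformed_dimProj_piRep_mul, hx]

/-- **Total flattening commutes with disc insertion modulo `relations₁₂`**:
`Φ_{N+2} ([π] * c) − [π] * Φ_N c ∈ relations₁₂`. [this work, COROLLARY NF.3] -/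
theorem soloInformed_totalFlat_piRep_mul_sub_mem (c : FormalRep) (N : ℕ) :
    soloInformedTotalFlat (N + 2) (of piRep * c) - of piRep * soloInformedTotalFlat N c ∈
      soloInformedEquidimRelations := by
  induction N with
  | zero =>
    have e : soloInformedTotalFlat (0 + 2) (of piRep * c) =
        soloInformedFlatMap (soloInformedFlatMap (soloInformedDimProj 0 (of piRep * c)) +
          soloInformedDimProj 1 (of piRep * c)) + soloInformedDimProj (0 + 2) (of piRep * c) := rfl
    rw [e, soloInformed_dimProj_piRep_mul_eq_zero (by norm_num : 0 < 2), map_zero, zero_add,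
      soloInformed_dimProj_piRep_mul_eq_zero (by norm_num : 1 < 2), map_zero, zero_add,
      soloInformed_dimProj_piRep_mul 0 c, soloInformed_totalFlat_zero_apply, sub_self]
    exact soloInformedEquidimRelations.zero_mem
  | succ N ih =>
    have e : soloInformedTotalFlat (N + 1 + 2) (of piRep * c) =
        soloInformedFlatMap (soloInformedTotalFlat (N + 2) (of piRep * c)) +
          soloInformedDimProj (N + 1 + 2) (of piRep * c) := rfl
    rw [e, soloInformed_totalFlat_succ_apply N c, mul_add, soloInformed_dimProj_piRep_mul (N + 1) c]
    have h1 : soloInformedFlatMap (soloInformedTotalFlat (N + 2) (of piRep * c)) -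
        soloInformedFlatMap (of piRep * soloInformedTotalFlat N c) ∈ soloInformedEquidimRelations := by
      rw [← map_sub]
      exact soloInformed_flatMap_mem_equidimRelations ih
    have h2 := soloInformed_flatMap_piRep_mul_sub_mem (soloInformedTotalFlat N c)
    have h := soloInformedEquidimRelations.add_mem h1 h2
    convert h using 1
    abel

/-! ### COROLLARY NF.3 (b): `T₁₂` implies `π`-cancellation -/

/-- **COROLLARY NF.3(b): `T₁₂ → KZ.PiCancellation`.**  If `[π] * c ∈ relations` then
`Φ_{N+2} ([π] * c) ∈ relations₁₂` for large `N` (torsion form of `relations`, THEOREM NF), i.e.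
`[π] * Φ_N c ∈ relations₁₂`; `T₁₂` gives `Φ_N c ∈ relations₁₂` for large `N`, i.e. `c ∈ relations`.
No stabilisation hypothesis is needed. [this work, COROLLARY NF.3(b)] -/
theorem soloInformed_piCancellation_of_discRegular (h : SoloInformedDiscRegular) : PiCancellation := by
  intro c hc
  rw [soloInformed_mem_relations_iff_totalFlat] at hc ⊢
  obtain ⟨M, hM⟩ := hc
  refine ⟨M, fun N hN => h N _ (soloInformed_dimProj_totalFlat N c) ?_⟩
  have h2 := soloInformedEquidimRelations.sub_mem (hM (N + 2) (by omega))
    (soloInformed_totalFlat_piRep_mul_sub_mem c N)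
  rwa [sub_sub_cancel] at h2

/-- **`KZ.PiLocalKernel → T₁₂ → KontsevichZagierPeriods`**: with the localised period conjecture,
disc regularity of the equidimensional group is enough for the summit.
[this work, COROLLARY NF.3(b); Kontsevich–Zagier 2001, §4.1; Ayoub 2014, Conj. 7] -/
theorem soloInformed_summit_of_piLocalKernel_of_discRegular (hloc : PiLocalKernel)
    (h : SoloInformedDiscRegular) : KontsevichZagierPeriods :=
  soloInformed_kzp_iff_piLocalKernel_and_piCancellation.mpr
    ⟨hloc, soloInformed_piCancellation_of_discRegular h⟩

/-! ### COROLLARY NF.3 (c): under STAB, `π`-cancellation is `T₁₂` -/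

/-- **COROLLARY NF.3(c), one direction**: STAB `→ KZ.PiCancellation → T₁₂` (for homogeneous `x`,
`[π] * x ∈ relations₁₂ ⊆ relations` gives `x ∈ relations`, and STAB makes `P₁₂ → P` injective).
[this work, COROLLARY NF.3(c)] -/
theorem soloInformed_discRegular_of_piCancellation_of_stab (hS : SoloInformedStab)
    (hP : PiCancellation) : SoloInformedDiscRegular := fun d x hx hdx =>
  (soloInformed_stab_iff_forall_mem_relations_imp.mp hS) d x hx
    (hP x (soloInformed_equidimRelations_le_relations hdx))

/-- **COROLLARY NF.3(c): under STAB, `KZ.PiCancellation ↔ T₁₂`.** [this work, COROLLARY NF.3(c)] -/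
theorem soloInformed_piCancellation_iff_discRegular_of_stab (hS : SoloInformedStab) :
    PiCancellation ↔ SoloInformedDiscRegular :=
  ⟨soloInformed_discRegular_of_piCancellation_of_stab hS, soloInformed_piCancellation_of_discRegular⟩

/-- Under STAB the summit splits as `KZ.PiLocalKernel ∧ T₁₂`. [this work, COROLLARY NF.3] -/
theorem soloInformed_summit_iff_piLocalKernel_and_discRegular_of_stab (hS : SoloInformedStab) :
    KontsevichZagierPeriods ↔ PiLocalKernel ∧ SoloInformedDiscRegular := by
  rw [soloInformed_kzp_iff_piLocalKernel_and_piCancellation,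
    soloInformed_piCancellation_iff_discRegular_of_stab hS]

/-! ### `T₁₂` from the equidimensional kernel conjecture; degree zero -/

/-- GKZ^dens_{d} `→ T₁₂` in degree `d` (`eval ([π] * x) = π · eval x`). [this work, COROLLARY NF.3] -/
theorem soloInformed_discRegularAt_of_equidimInjAt (h : SoloInformedEquidimInjAt d) :
    SoloInformedDiscRegularAt d := by
  intro x hx hdx
  refine h x hx ?_
  have h1 := soloInformed_eval_eq_zero_of_mem_equidimRelations hdx
  rw [eval_mul', eval_of_piRep] at h1
  exact (mul_eq_zero.mp h1).resolve_left Real.pi_ne_zero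

/-- GKZ^dens `→ T₁₂`. [this work, COROLLARY NF.3] -/
theorem soloInformed_discRegular_of_equidimInj (h : SoloInformedEquidimInj) :
    SoloInformedDiscRegular := fun d => soloInformed_discRegularAt_of_equidimInjAt (h d)

/-- **`T₁₂` holds in degree `0`** (point representations: `[π] * [pt, a] ∈ relations₁₂` forces
`π a = 0`). [this work, COROLLARY NF.3 (degree 0)] -/
theorem soloInformed_discRegularAt_zero : SoloInformedDiscRegularAt 0 :=
  soloInformed_discRegularAt_of_equidimInjAt soloInformed_equidimInjAt_zero

end Summit.KontsevichZagierPeriods.KontsevichZagierPeriods.Theorems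

end
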